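import Literature.AlgebraicGeometry.Frobenioids.BaseFrobeniusPairCalculus
import Literature.AlgebraicGeometry.Frobenioids.ProfiniteUnitsDecomposition
import Literature.AlgebraicGeometry.Frobenioids.ProfiniteUnitsNaturality
import HarnessLib

/-!
# Frobenioids I, Proposition 2.9 (ii): the map `β = β₀ · β₁ ↦ β₀^ζ · β₁` on `O^▷(A)`

Mochizuki, *The geometry of Frobenioids I: the general theory*, Kyushu J. Math. **62** (2008)
293–400, §2, proof of Proposition 2.9 (ii), kurims text p.54
[cite: MochizukiFrdI2008, Prop. 2.9(ii) p.54]: "by applying the characteristic splitting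
`O^×(C) × τ(C) ⥲ O^▷(C)`, we may write `β = β₀ · β₁` [where `β₀ ∈ O^×(C)`, `β₁ ∈ τ(C)`].  Set
`Ψ(β) := β₀^ζ · β₁` [where "`(−)^ζ`" is as defined in Definition 2.8, (iii)]."

For a Frobenioid of unit-profinite type, an isotropic object `A` and `ζ : Primes → ℕ_{≥1}`:
`unitsToEnd` (`O^×(A) ↪ O^▷(A)`), the chosen profinite topology and `ζ`-th power map `zetaPow` on
`O^×(A)` (Def. 2.8 (i), (iii) — existence from `ProfiniteUnitsDecomposition.lean`), and the monoid
endomorphism `zetaUnitMap : O^▷(A) → O^▷(A)`, `β₀ · β₁ ↦ β₀^ζ · β₁`, with: its values on units and on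
`τ(A)`, `Div ∘ Ψ = Div`, compatibility with the restrictions `α^*` along `P`-distinguished arrows of
a base-Frobenius pair ("raising to the `ζ`-th power defines an endomorphism of the functor in monoids
`O^×(−)`", via the naturality of `ProfiniteUnitsNaturality.lean`), triviality for unit-trivial `A`,
and bijectivity for `ζ` of co-prime type.
-/

noncomputable section

namespace Literature.AlgebraicGeometry.Frobenioids

open CategoryTheory Opposite

universe w v v' u u'

namespace PreFrobenioid

variable {D : Type u} [Category.{v} D] {Φ : Dᵒᵖ ⥤ CommMonCat.{w}}
  {C : Type u'} [Category.{v'} C] {F : C ⥤ ElemFrobenioid Φ}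

/-! ### `O^×(A) ↪ O^▷(A)` -/

variable (F) in
/-- The inclusion `O^×(A) ↪ O^▷(A)` as a homomorphism of monoids. [cite: MochizukiFrdI2008, Def. 1.2(ii) p.22] -/
def unitsToEnd (A : C) : unitsSubgroup F A →* endSubmonoid F A where
  toFun u := ⟨(u.1.hom : End A), u.2⟩
  map_one' := rfl
  map_mul' _ _ := rfl

/-- Underlying arrow of `unitsToEnd`. [cite: MochizukiFrdI2008, Def. 1.2(ii) p.22] -/
theorem unitsToEnd_val {A : C} (u : unitsSubgroup F A) : ((unitsToEnd F A u).1 : A ⟶ A) = u.1.hom := rfl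

/-- `O^×(A) ↪ O^▷(A)` is injective. [cite: MochizukiFrdI2008, Def. 1.2(ii) p.22] -/
theorem unitsToEnd_injective (A : C) : Function.Injective (unitsToEnd F A) := fun _ _ h =>
  Subtype.ext (Iso.ext (congrArg (fun e : endSubmonoid F A => (e.1 : A ⟶ A)) h))

/-- Elements of `O^×(A)` are units of `O^▷(A)`. [cite: MochizukiFrdI2008, Def. 1.2(ii) p.22] -/
theorem isUnit_unitsToEnd {A : C} (u : unitsSubgroup F A) : IsUnit (unitsToEnd F A u) :=
  (isUnit_endSubmonoid_iff F _).mpr ⟨u.1, u.2, rfl⟩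

/-- A unit of `O^▷(A)` comes from a unique element of `O^×(A)`. [cite: MochizukiFrdI2008, Def. 1.2(ii) p.22] -/
theorem existsUnique_unitsToEnd_eq {A : C} {e : endSubmonoid F A} (he : IsUnit e) :
    ∃! u : unitsSubgroup F A, unitsToEnd F A u = e := by
  obtain ⟨α, hα, hαe⟩ := (isUnit_endSubmonoid_iff F e).mp he
  exact ⟨⟨α, hα⟩, Subtype.ext hαe, fun u hu => unitsToEnd_injective A (hu.trans (Subtype.ext hαe).symm)⟩

/-- The element of `O^×(A)` underlying a unit of `O^▷(A)`. [cite: MochizukiFrdI2008, Def. 1.2(ii) p.22] -/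
def unitOf {A : C} {e : endSubmonoid F A} (he : IsUnit e) : unitsSubgroup F A :=
  (existsUnique_unitsToEnd_eq he).choose

/-- `unitOf` inverts `unitsToEnd`. [cite: MochizukiFrdI2008, Def. 1.2(ii) p.22] -/
theorem unitsToEnd_unitOf {A : C} {e : endSubmonoid F A} (he : IsUnit e) : unitsToEnd F A (unitOf he) = e :=
  (existsUnique_unitsToEnd_eq he).choose_spec.1

/-- `unitOf (unitsToEnd u) = u`. [cite: MochizukiFrdI2008, Def. 1.2(ii) p.22] -/
theorem unitOf_unitsToEnd {A : C} (u : unitsSubgroup F A) (h : IsUnit (unitsToEnd F A u)) : unitOf h = u :=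
  unitsToEnd_injective A (unitsToEnd_unitOf h)

/-! ### The profinite topology and the `ζ`-th power map on `O^×(A)` -/

section Zeta

variable (hF : IsFrobenioid F) (hup : IsOfUnitProfiniteType F) (ζ : Nat.Primes → ℕ+)

/-- The chosen profinite topology of `O^×(A)` (Def. 2.8 (i)). [cite: MochizukiFrdI2008, Def. 2.8(i) p.52] -/
@[reducible] def unitsTopology (A : C) : TopologicalSpace (unitsSubgroup F A) := (hup A).choose

/-- The chosen topology makes `O^×(A)` a topologically finitely generated profinite group.
[cite: MochizukiFrdI2008, Def. 2.8(i) p.52] -/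
theorem isTfgProfinite_unitsTopology (A : C) : @IsTfgProfinite _ _ (unitsTopology hup A) := (hup A).choose_spec

/-- **"Raising to the `ζ`-th power" on `O^×(A)`** (Def. 2.8 (iii)), as a homomorphism of groups.
[cite: MochizukiFrdI2008, Def. 2.8(iii) p.52] -/
def zetaPow (A : C) : unitsSubgroup F A →* unitsSubgroup F A :=
  letI : CommGroup (unitsSubgroup F A) := unitsCommGroup F hF A
  letI : TopologicalSpace (unitsSubgroup F A) := unitsTopology hup A
  ((isTfgProfinite_unitsTopology hup A).exists_zetaPowerMap ζ).choose_spec.choose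

/-- `zetaPow` is the `ζ`-th power map for the chosen topology. [cite: MochizukiFrdI2008, Def. 2.8(iii) p.52] -/
theorem isZetaPowerMap_zetaPow (A : C) :
    @IsZetaPowerMap (unitsSubgroup F A) (unitsCommGroup F hF A) (unitsTopology hup A) ζ (zetaPow hF hup ζ A) :=
  letI : CommGroup (unitsSubgroup F A) := unitsCommGroup F hF A
  letI : TopologicalSpace (unitsSubgroup F A) := unitsTopology hup A
  ((isTfgProfinite_unitsTopology hup A).exists_zetaPowerMap ζ).choose_spec.choose_spec.2.2

/-- Naturality of the `ζ`-th power maps under any homomorphism `O^×(B) → O^×(A)`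
(`ProfiniteUnitsNaturality.map_zetaPowerMap`). [cite: MochizukiFrdI2008, Prop. 2.9(ii) p.54] -/
theorem map_zetaPow {A B : C} (h : unitsSubgroup F B →* unitsSubgroup F A) (x : unitsSubgroup F B) :
    h (zetaPow hF hup ζ B x) = zetaPow hF hup ζ A (h x) := by
  letI : CommGroup (unitsSubgroup F A) := unitsCommGroup F hF A
  letI : TopologicalSpace (unitsSubgroup F A) := unitsTopology hup A
  letI : CommGroup (unitsSubgroup F B) := unitsCommGroup F hF B
  letI : TopologicalSpace (unitsSubgroup F B) := unitsTopology hup B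
  exact (isTfgProfinite_unitsTopology hup B).map_zetaPowerMap (isTfgProfinite_unitsTopology hup A)
    (isZetaPowerMap_zetaPow hF hup ζ B) (isZetaPowerMap_zetaPow hF hup ζ A) h x

/-- For `ζ` of co-prime type the `ζ`-th power map is bijective (Def. 2.8 (iii), bracket).
[cite: MochizukiFrdI2008, Def. 2.8(iii) p.53] -/
theorem zetaPow_bijective (hζ : IsOfCoprimeType ζ) (A : C) : Function.Bijective (zetaPow hF hup ζ A) :=
  letI : CommGroup (unitsSubgroup F A) := unitsCommGroup F hF A
  letI : TopologicalSpace (unitsSubgroup F A) := unitsTopology hup A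
  ZetaPowerMapBijectiveOfCoprime_holds (unitsSubgroup F A) ζ (isTfgProfinite_unitsTopology hup A) hζ _
    (isZetaPowerMap_zetaPow hF hup ζ A)

/-- On a trivial group of units the `ζ`-th power map is the identity. [cite: MochizukiFrdI2008, Prop. 2.9(ii) p.55] -/
theorem zetaPow_of_isUnitTrivial {A : C} (hut : IsUnitTrivial F A) (u : unitsSubgroup F A) :
    zetaPow hF hup ζ A u = u :=
  Subtype.ext ((hut _ (zetaPow hF hup ζ A u).2).trans (hut _ u.2).symm)

/-! ### The splitting `β = β₀ · β₁` -/

variable (τ : CharacteristicSplitting F)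

/-- The inclusion `τ(A) ↪ O^▷(A)` (isotropic `A`) as a homomorphism of monoids.
[cite: MochizukiFrdI2008, Def. 2.3 p.47] -/
def tauToEnd {A : C} (hA : IsIsotropic F A) : τ.τ A →* endSubmonoid F A where
  toFun t := ⟨t.1, τ.τ_le hA t.2⟩
  map_one' := rfl
  map_mul' _ _ := rfl

/-- Values of `tauToEnd` lie in `τ(A)`. [cite: MochizukiFrdI2008, Def. 2.3 p.47] -/
theorem tauToEnd_mem {A : C} (hA : IsIsotropic F A) (t : τ.τ A) : ((tauToEnd τ hA t).1 : End A) ∈ τ.τ A := t.2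

/-- An element of `O^▷(A)` lying in `τ(A)` is in the image of `tauToEnd`. [cite: MochizukiFrdI2008, Def. 2.3 p.47] -/
theorem tauToEnd_mk {A : C} (hA : IsIsotropic F A) {e : endSubmonoid F A} (he : (e.1 : End A) ∈ τ.τ A) :
    tauToEnd τ hA ⟨e.1, he⟩ = e := rfl

/-- The splitting map on components. [cite: MochizukiFrdI2008, Def. 2.3 p.47] -/
theorem splitMap_mk {A : C} (hA : IsIsotropic F A) (u : unitsSubgroup F A) (t : τ.τ A) :
    τ.splitMap hA (u, t) = unitsToEnd F A u * tauToEnd τ hA t := rfl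

/-- The unit part `β₀` of `β = β₀ · β₁`. [cite: MochizukiFrdI2008, Def. 2.3 p.47] -/
def splitU {A : C} (hA : IsIsotropic F A) (β : endSubmonoid F A) : unitsSubgroup F A :=
  (τ.splitMap_surjective hF hA β).choose.1

/-- The `τ`-part `β₁` of `β = β₀ · β₁`. [cite: MochizukiFrdI2008, Def. 2.3 p.47] -/
def splitT {A : C} (hA : IsIsotropic F A) (β : endSubmonoid F A) : τ.τ A :=
  (τ.splitMap_surjective hF hA β).choose.2

/-- `β = β₀ · β₁`. [cite: MochizukiFrdI2008, Def. 2.3 p.47] -/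
theorem split_spec {A : C} (hA : IsIsotropic F A) (β : endSubmonoid F A) :
    unitsToEnd F A (splitU hF τ hA β) * tauToEnd τ hA (splitT hF τ hA β) = β :=
  (τ.splitMap_surjective hF hA β).choose_spec

/-- Uniqueness of the splitting. [cite: MochizukiFrdI2008, Def. 2.3 p.47] -/
theorem split_unique {A : C} (hA : IsIsotropic F A) {β : endSubmonoid F A} {u : unitsSubgroup F A} {t : τ.τ A}
    (h : unitsToEnd F A u * tauToEnd τ hA t = β) : splitU hF τ hA β = u ∧ splitT hF τ hA β = t := by
  have h' : τ.splitMap hA (splitU hF τ hA β, splitT hF τ hA β) = τ.splitMap hA (u, t) := by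
    rw [splitMap_mk, splitMap_mk, split_spec, h]
  have h'' := τ.splitMap_injective hF hA h'
  exact ⟨congrArg Prod.fst h'', congrArg Prod.snd h''⟩

/-- The splitting of a product (commutativity of `O^▷(A)`). [cite: MochizukiFrdI2008, Def. 2.3 p.47] -/
theorem split_mul {A : C} (hA : IsIsotropic F A) (β β' : endSubmonoid F A) :
    splitU hF τ hA (β * β') = splitU hF τ hA β * splitU hF τ hA β' ∧
      splitT hF τ hA (β * β') = splitT hF τ hA β * splitT hF τ hA β' := by
  apply split_unique hF τ hA
  rw [map_mul, map_mul]
  conv_rhs => rw [← split_spec hF τ hA β, ← split_spec hF τ hA β']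
  set u := unitsToEnd F A (splitU hF τ hA β)
  set u' := unitsToEnd F A (splitU hF τ hA β')
  set t := tauToEnd τ hA (splitT hF τ hA β)
  set t' := tauToEnd τ hA (splitT hF τ hA β')
  rw [mul_assoc, mul_assoc, ← mul_assoc u' t t', endSubmonoid_comm F hF u' t, mul_assoc]

/-! ### `Ψ(β) := β₀^ζ · β₁` -/

/-- **`Ψ_A : O^▷(A) → O^▷(A)`, `β₀ · β₁ ↦ β₀^ζ · β₁`**, as a homomorphism of monoids.
[cite: MochizukiFrdI2008, Prop. 2.9(ii) p.54] -/
def zetaUnitMap {A : C} (hA : IsIsotropic F A) : endSubmonoid F A →* endSubmonoid F A where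
  toFun β := unitsToEnd F A (zetaPow hF hup ζ A (splitU hF τ hA β)) * tauToEnd τ hA (splitT hF τ hA β)
  map_one' := by
    obtain ⟨h1, h2⟩ := split_unique hF τ hA (β := 1) (u := 1) (t := 1) (by rw [map_one, map_one, mul_one])
    rw [h1, h2, map_one, map_one, map_one, mul_one]
  map_mul' β β' := by
    obtain ⟨h1, h2⟩ := split_mul hF τ hA β β'
    rw [h1, h2, map_mul, map_mul, map_mul]
    set u := unitsToEnd F A (zetaPow hF hup ζ A (splitU hF τ hA β))
    set u' := unitsToEnd F A (zetaPow hF hup ζ A (splitU hF τ hA β'))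
    set t := tauToEnd τ hA (splitT hF τ hA β)
    set t' := tauToEnd τ hA (splitT hF τ hA β')
    rw [mul_assoc, mul_assoc, ← mul_assoc u' t t', endSubmonoid_comm F hF u' t, mul_assoc]

/-- `Ψ_A` on a split element `u · t`. [cite: MochizukiFrdI2008, Prop. 2.9(ii) p.54] -/
theorem zetaUnitMap_of_split {A : C} (hA : IsIsotropic F A) {β : endSubmonoid F A} {u : unitsSubgroup F A}
    {t : τ.τ A} (h : unitsToEnd F A u * tauToEnd τ hA t = β) :
    zetaUnitMap hF hup ζ τ hA β = unitsToEnd F A (zetaPow hF hup ζ A u) * tauToEnd τ hA t := by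
  obtain ⟨h1, h2⟩ := split_unique hF τ hA h
  show unitsToEnd F A (zetaPow hF hup ζ A (splitU hF τ hA β)) * tauToEnd τ hA (splitT hF τ hA β) = _
  rw [h1, h2]

/-- `Ψ_A` on units is the `ζ`-th power. [cite: MochizukiFrdI2008, Prop. 2.9(ii) p.54] -/
theorem zetaUnitMap_unitsToEnd {A : C} (hA : IsIsotropic F A) (u : unitsSubgroup F A) :
    zetaUnitMap hF hup ζ τ hA (unitsToEnd F A u) = unitsToEnd F A (zetaPow hF hup ζ A u) := by
  rw [zetaUnitMap_of_split hF hup ζ τ hA (u := u) (t := 1) (by rw [map_one, mul_one]), map_one, mul_one]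

/-- `Ψ_A` is the identity on `τ(A)`. [cite: MochizukiFrdI2008, Prop. 2.9(ii) p.54] -/
theorem zetaUnitMap_of_mem_tau {A : C} (hA : IsIsotropic F A) {t : endSubmonoid F A} (ht : (t.1 : End A) ∈ τ.τ A) :
    zetaUnitMap hF hup ζ τ hA t = t := by
  rw [zetaUnitMap_of_split hF hup ζ τ hA (u := 1) (t := ⟨t.1, ht⟩) (by rw [map_one, one_mul]; rfl),
    map_one, map_one, one_mul]
  rfl

/-- `Div ∘ Ψ_A = Div` (units have trivial divisor). [cite: MochizukiFrdI2008, Prop. 2.9(ii) p.55] -/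
theorem divHom_zetaUnitMap {A : C} (hA : IsIsotropic F A) (β : endSubmonoid F A) :
    divHom F A (zetaUnitMap hF hup ζ τ hA β) = divHom F A β := by
  have hP := hF.isPreFrobenioid
  conv_rhs => rw [← split_spec hF τ hA β]
  show divHom F A (unitsToEnd F A _ * tauToEnd τ hA _) = _
  rw [map_mul, map_mul, divHom_eq_one_of_isUnit F hP (isUnit_unitsToEnd _),
    divHom_eq_one_of_isUnit F hP (isUnit_unitsToEnd _)]

/-- For unit-trivial `A`, `Ψ_A = id`. [cite: MochizukiFrdI2008, Prop. 2.9(ii) p.55] -/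
theorem zetaUnitMap_of_isUnitTrivial {A : C} (hA : IsIsotropic F A) (hut : IsUnitTrivial F A) (β : endSubmonoid F A) :
    zetaUnitMap hF hup ζ τ hA β = β := by
  conv_rhs => rw [← split_spec hF τ hA β]
  show unitsToEnd F A _ * tauToEnd τ hA _ = _
  rw [zetaPow_of_isUnitTrivial hF hup ζ hut]

/-- For `ζ` of co-prime type, `Ψ_A` is bijective. [cite: MochizukiFrdI2008, Prop. 2.9(ii) p.55] -/
theorem zetaUnitMap_bijective (hζ : IsOfCoprimeType ζ) {A : C} (hA : IsIsotropic F A) :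
    Function.Bijective (zetaUnitMap hF hup ζ τ hA) := by
  have hb := zetaPow_bijective hF hup ζ hζ A
  constructor
  · intro β β' h
    obtain ⟨h1, h2⟩ := split_unique hF τ hA (β := zetaUnitMap hF hup ζ τ hA β')
      (u := zetaPow hF hup ζ A (splitU hF τ hA β)) (t := splitT hF τ hA β) h
    obtain ⟨h1', h2'⟩ := split_unique hF τ hA (β := zetaUnitMap hF hup ζ τ hA β')
      (u := zetaPow hF hup ζ A (splitU hF τ hA β')) (t := splitT hF τ hA β') rfl
    have hu : splitU hF τ hA β = splitU hF τ hA β' := hb.1 (h1.symm.trans h1')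
    have ht : splitT hF τ hA β = splitT hF τ hA β' := h2.symm.trans h2'
    rw [← split_spec hF τ hA β, ← split_spec hF τ hA β', hu, ht]
  · intro β
    obtain ⟨u, hu⟩ := hb.2 (splitU hF τ hA β)
    refine ⟨unitsToEnd F A u * tauToEnd τ hA (splitT hF τ hA β), ?_⟩
    rw [zetaUnitMap_of_split hF hup ζ τ hA rfl, hu, split_spec]

/-! ### Compatibility with restriction along `P`-distinguished arrows -/

variable {P : Presection C} (hP : IsBaseSection F P)

/-- `α^*` on `O^×`: the homomorphism `O^×(B) → O^×(A)` induced by `α^* : O^▷(B) → O^▷(A)`.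
[cite: MochizukiFrdI2008, Prop. 2.9(ii) p.54] -/
def resUnits {A B : C} {α : A ⟶ B} (hα : P.hom α) : unitsSubgroup F B →* unitsSubgroup F A where
  toFun u := unitOf (BaseFrobeniusPair.isUnit_resP hF hP hα (isUnit_unitsToEnd u))
  map_one' := by
    apply unitsToEnd_injective A
    rw [unitsToEnd_unitOf, map_one, map_one, map_one]
  map_mul' u v := by
    apply unitsToEnd_injective A
    rw [unitsToEnd_unitOf, map_mul, map_mul, map_mul, unitsToEnd_unitOf, unitsToEnd_unitOf]

/-- `unitsToEnd (α^* u) = α^* (unitsToEnd u)`. [cite: MochizukiFrdI2008, Prop. 2.9(ii) p.54] -/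
theorem unitsToEnd_resUnits {A B : C} {α : A ⟶ B} (hα : P.hom α) (u : unitsSubgroup F B) :
    unitsToEnd F A (resUnits hF hP hα u) = BaseFrobeniusPair.resP hF hP hα (unitsToEnd F B u) :=
  unitsToEnd_unitOf (BaseFrobeniusPair.isUnit_resP hF hP hα (isUnit_unitsToEnd u))

/-- `α^*` maps `τ(B)` to `τ(A)` (as elements of `tauToEnd`). [cite: MochizukiFrdI2008, Def. 2.3 p.47] -/
theorem resP_tauToEnd {A B : C} (hA : IsIsotropic F A) (hB : IsIsotropic F B) {α : A ⟶ B} (hα : P.hom α)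
    (t : τ.τ B) :
    BaseFrobeniusPair.resP hF hP hα (tauToEnd τ hB t) =
      tauToEnd τ hA ⟨(BaseFrobeniusPair.resP hF hP hα (tauToEnd τ hB t)).1,
        BaseFrobeniusPair.resP_mem_tau hF hP τ hA hB hα (tauToEnd_mem τ hB t)⟩ := rfl

/-- **`Ψ` commutes with `α^*`** for `P`-distinguished `α : A → B` between isotropic objects:
`Ψ_A(α^*β) = α^*(Ψ_B β)` — `α^*` preserves the splitting (units to units, `τ(B)` into `τ(A)`,
Def. 2.3) and commutes with the `ζ`-th powers (naturality, Def. 2.8).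
[cite: MochizukiFrdI2008, Prop. 2.9(ii) p.55] -/
theorem zetaUnitMap_resP {A B : C} (hA : IsIsotropic F A) (hB : IsIsotropic F B) {α : A ⟶ B} (hα : P.hom α)
    (β : endSubmonoid F B) :
    zetaUnitMap hF hup ζ τ hA (BaseFrobeniusPair.resP hF hP hα β) =
      BaseFrobeniusPair.resP hF hP hα (zetaUnitMap hF hup ζ τ hB β) := by
  have hsplit : unitsToEnd F A (resUnits hF hP hα (splitU hF τ hB β)) *
      tauToEnd τ hA ⟨(BaseFrobeniusPair.resP hF hP hα (tauToEnd τ hB (splitT hF τ hB β))).1,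
        BaseFrobeniusPair.resP_mem_tau hF hP τ hA hB hα (tauToEnd_mem τ hB _)⟩ =
      BaseFrobeniusPair.resP hF hP hα β := by
    rw [unitsToEnd_resUnits, ← resP_tauToEnd hF τ hP hA hB hα, ← map_mul, split_spec]
  rw [zetaUnitMap_of_split hF hup ζ τ hA hsplit, ← map_zetaPow hF hup ζ (resUnits hF hP hα),
    unitsToEnd_resUnits, ← resP_tauToEnd hF τ hP hA hB hα, ← map_mul,
    zetaUnitMap_of_split hF hup ζ τ hB (split_spec hF τ hB β)]

end Zeta

end PreFrobenioid

end Literature.AlgebraicGeometry.Frobenioids
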